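import Summits.BirchSwinnertonDyer.BirchSwinnertonDyer.Theorems.SmallImageMuTransferMuTransferX9KolyvaginValueDivision
import Summits.BirchSwinnertonDyer.BirchSwinnertonDyer.Theorems.SmallImageMuTransferMuTransferX9EulerFactorModP
import Literature.NumberTheory.EllipticCurves.IwasawaTwistModPTower
import Literature.NumberTheory.EllipticCurves.IwasawaTwistModPShapiro
import HarnessLib

/-!
# K6 crux `MuTransferX9` (stmt-BirchSwinnertonDyer-19276), skeleton v6d stub `stub_stepsTwoFourOdd`:
# the VALUE of the Kolyvagin cocycle ASSEMBLED — from the key relation at level `L = p^{n+1}`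
# (`(φ̃ − 1)·a' = −P̄(φ̃)·t`, x10 p469014 / koly `exists_tameClass_of_isEulerSystemClass`) to the
# stub's right-hand side `U(S)·S^{e'+1+a}·Φ(Fr)` at level `J = 2e'+2` (`U ∈ ℤ[X]`, `p ∤ U(0)`)

Cell `bsd-smallim`, seat `bsd-smallim-k6-g3` (gen 2).  THEOREMS ONLY (no definition, no named fact,
no `sorry`).  HONEST FRAMING: helper toward the registered stub `stub_stepsTwoFourOdd` (skeleton v6d
`100eb8c6a7ccf73b`) of crux 19276; closes nothing.  PARTITION (D-0054): X9 (A4) × p ∈ {5,7}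
(+ X10b∧¬Surj at 3: odd `p`, any field) — helper; closes NONE.  Continuation of this seat's p451789
`…X9KolyvaginValueDivision`; the algebraic half of the hVal split with x10 g39 (STATUS l.339): x10's
`exists_kolyvaginCocycle_value` (p469014) ends in the KEY RELATION `𝒯_L(r)·a' − a' = −ψ'(r)`,
`Φ_q(res τ_q) = −(a' mod T^J)`; koly's tame class gives `ψ'(g) = P̄((1+S)^a)(φ₁(g))`,
`P̄ ≡ (1 − X)² (mod p)` (lur-a p468436 (B)), `a ≡ κ̄(Fr)`; this file turns that into the stub's value.

## The computation (MU-TRANSFER-PROOF §3: "`(φ̃ − 1)t_N = −P·t_1`, hence `κ̃(σ) = U'·T^e·t̄_1`")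

`φ̃ = (1+S)^{pᵐu}` (`p ∤ u`) = the action of an `E`-split Frobenius of depth `m` on `𝒯_L`,
`P̄ ≡ (1 − X)² (mod p)`.  §1 `P̄(φ̃) = (φ̃ − 1) ∘ S^{pᵐ} ∘ V(S)`, `V ∈ ℤ[X]`, `V(0) = u` (POLYNOMIAL
refinement of lur-a's abstract-unit form; the stub wants `aeval (shiftEnd …) U`).  §2 the key
relation `φ̃ a' − a' = −P̄(φ̃) t` at level `L` gives `−(a' mod T^J) = S^{pᵐ}·V(S)·(t mod T^J)` for
`J + pᵐ ≤ L` (p451789 `neg_castLE_eq_shiftEnd_pow_aeval_castLE`).  §3 coboundary correction: if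
`(t mod T^J) − S^{a₀} v = (1+S)^c b − b`, `pᵐ ∣ c`, `J ≤ 2pᵐ`, then `S^{pᵐ}·V(S)·(t mod T^J) =
V(S)·S^{pᵐ+a₀}·v` (`S^{2pᵐ} = 0`).  §4 NET: `∃ U ∈ ℤ[X], p ∤ U(0), −(a' mod T^J) = U(S)·S^{pᵐ+a₀}·v`.
§5 Galois currency (`𝒯_J = κ.twistModP ρ hM J`): koly's exponent `a ≡ κ̄_{n'}(τ)` is the twist
exponent of `τ`; the stub's `towerShift^[a₀] κ' = 𝐳̄`, `[Φ] = κ'_J`, `[φ₁] = 𝐳̄_L` give the pointwise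
coboundary `(φ₁(g) mod T^J) − S^{a₀}Φ(g) = g·b − b`; assembled:
**`exists_poly_neg_castLE_eq_of_towerShift_iterate_eq`** / **`…_stubLevels`** — for an `E`-split
`τ` of depth `m` and the key relation `𝒯_L(τ) a' − a' = −P̄((1+S)^a)(φ₁(τ))`:
`∃ U : ℤ[X], ¬ (p:ℤ) ∣ U.coeff 0 ∧ (fun i ↦ −a' (Fin.castLE _ i)) =
 aeval (shiftEnd M J) U ((shiftEnd M J)^(e'+1+a₀) (Φ.1 τ))` — the right-hand side of
`stub_stepsTwoFourOdd` / of lur-b's `hTame` clause (V), at `τ`.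

References: HOME/koly/MU-TRANSFER-PROOF.md §3 (Lemma 2, COCHAINS and VALUES), (F5); B. Perrin-Riou,
Ann. Inst. Fourier 48 (1998) Prop. 2.2.5, Prop. 3.1.6 [PerrinRiou1998AIF]; K. Rubin, *Euler Systems*
(2000) Def. 2.1.1, Lemma 4.4.2, Thm. 4.5.4 [Rubin2000]; L. Washington, *Introduction to Cyclotomic
Fields* (1997) §13.2 [Washington1997].
-/

-- the summit and its single problem are both named `BirchSwinnertonDyer` (registry layout D-0017)
set_option linter.dupNamespace false
set_option autoImplicit false

noncomputable section

open Function Finset Polynomial Field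
open Literature.NumberTheory.GaloisRepresentations
open Literature.NumberTheory.EllipticCurves
open Literature.NumberTheory.EllipticCurves.ZpExtension
open Summit.BirchSwinnertonDyer.BirchSwinnertonDyer.Rank1Residual.LocalSplitPrime

namespace Summit.BirchSwinnertonDyer.BirchSwinnertonDyer.Rank1Residual.KolyvaginTwist

/-! ### §1 The reduced Euler factor at `φ̃ = (1+S)^{pᵐu}` as `(φ̃ − 1) ∘ S^{pᵐ} ∘ V(S)`, `V ∈ ℤ[X]` -/

section Operator

variable {M : Type*} [AddCommGroup M] {p : ℕ} [Fact p.Prime] {L : ℕ}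

/-- For `P̄ ≡ (1 − X)² (mod p)` and any endomorphism `g` of the `p`-torsion module `Fin L → M`,
`P̄(g) = (g − 1)·(g − 1)` (lur-a's `aeval_eq_aeval_of_map_castRingHom_eq`: congruent integer
polynomials act alike). [cite: Washington1997, §13.2 (arithmetic in Λ/(p, T^n))] -/
theorem aeval_eq_sub_one_mul_sub_one (hM : ∀ x : M, p • x = 0) (g : Module.End ℤ (Fin L → M))
    {Pz : ℤ[X]}
    (hPz : Pz.map (Int.castRingHom (ZMod p)) = ((1 - X) ^ 2 : ℤ[X]).map (Int.castRingHom (ZMod p))) :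
    aeval g Pz = (g - 1) * (g - 1) := by
  rw [EulerFactorModP.aeval_eq_aeval_of_map_castRingHom_eq p hM g hPz, map_pow, map_sub, map_one,
    aeval_X, ← neg_sub, neg_sq, sq]

/-- **`P̄(φ̃) = (φ̃ − 1) ∘ S^{pᵐ} ∘ V(S)` with `V` a POLYNOMIAL, `V(0) = u`.**  For `φ̃ = (1+S)^{pᵐ·u}`
on `Fin L → M` (`p·M = 0`) and `P̄ ≡ (1 − X)² (mod p)`: `P̄(φ̃) x = (φ̃ − 1)(S^{pᵐ}(V(S) x))` for all
`x`, where `(1+S)^{pᵐu} − 1 = S^{pᵐ}·V(S)` (`exists_poly_unipotentPow_sub_one_eq`, (F5)).  This is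
the shape `hrel` of the division lemma `neg_castLE_eq_shiftEnd_pow_aeval_castLE`.
[cite: Washington1997, §13.2 (arithmetic in Λ/(p, T^n))] -/
theorem exists_poly_aeval_unipotentPow_apply_eq (hM : ∀ x : M, p • x = 0) (m u : ℕ) {Pz : ℤ[X]}
    (hPz : Pz.map (Int.castRingHom (ZMod p)) = ((1 - X) ^ 2 : ℤ[X]).map (Int.castRingHom (ZMod p))) :
    ∃ V : ℤ[X], V.coeff 0 = (u : ℤ) ∧ ∀ x : Fin L → M,
      aeval (unipotentPow M L (p ^ m * u)) Pz x =
        (unipotentPow M L (p ^ m * u) - 1)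
          ((shiftEnd M L ^ (p ^ m)) (aeval (shiftEnd M L) V x)) := by
  obtain ⟨V, hV0, hV⟩ := exists_poly_unipotentPow_sub_one_eq (J := L) hM m u
  refine ⟨V, hV0, fun x => ?_⟩
  rw [aeval_eq_sub_one_mul_sub_one hM _ hPz, Module.End.mul_apply]
  congr 1
  rw [hV, Module.End.mul_apply]

end Operator

/-! ### §2 Division: from the key relation at level `L` to the value modulo `T^J` -/

section Division

variable {M : Type*} [AddCommGroup M] {p : ℕ} [Fact p.Prime]

/-- **The key relation divided.**  If `φ̃ a' − a' = −P̄(φ̃) t` in `Fin L → M` (`φ̃ = (1+S)^{pᵐu}`,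
`p ∤ u`, `P̄ ≡ (1 − X)²` — MU-TRANSFER-PROOF §3 "`(φ̃ − 1)t_N = −P·t_1`" at finite level), then at
every level `J` with `J + pᵐ ≤ L`: `−(a' mod T^J) = S^{pᵐ}·V(S)·(t mod T^J)` for a polynomial `V` with
`V(0) = u` (truncation = first `J` coordinates, `Fin.castLE`). [cite: PerrinRiou1998AIF, Prop. 2.2.5 and Prop. 3.1.6] -/
theorem exists_poly_neg_castLE_eq_of_keyRelation (hM : ∀ x : M, p • x = 0) (m u : ℕ) (hu : ¬ p ∣ u)
    {L J : ℕ} (hJL : J + p ^ m ≤ L) {Pz : ℤ[X]}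
    (hPz : Pz.map (Int.castRingHom (ZMod p)) = ((1 - X) ^ 2 : ℤ[X]).map (Int.castRingHom (ZMod p)))
    (a' t : Fin L → M)
    (hkey : unipotentPow M L (p ^ m * u) a' - a' = -(aeval (unipotentPow M L (p ^ m * u)) Pz t)) :
    ∃ V : ℤ[X], V.coeff 0 = (u : ℤ) ∧
      (fun i : Fin J => -a' (Fin.castLE (by omega) i)) =
        (shiftEnd M J ^ (p ^ m)) (aeval (shiftEnd M J) V fun i => t (Fin.castLE (by omega) i)) := by
  obtain ⟨V, hV0, hV⟩ := exists_poly_aeval_unipotentPow_apply_eq (L := L) hM m u hPz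
  refine ⟨V, hV0, ?_⟩
  have hrel : (unipotentPow M L (p ^ m * u) - 1) a' =
      -((unipotentPow M L (p ^ m * u) - 1)
        ((shiftEnd M L ^ (p ^ m)) (aeval (shiftEnd M L) V t))) := by
    rw [LinearMap.sub_apply, Module.End.one_apply, hkey, hV]
  exact neg_castLE_eq_shiftEnd_pow_aeval_castLE hM m u hu hJL a' t (p ^ m) V hrel

end Division

/-! ### §3 The coboundary correction at level `J ≤ 2pᵐ` -/

section Coboundary

variable {M : Type*} [AddCommGroup M] {p : ℕ} [Fact p.Prime] {J : ℕ}

/-- `(1+S)^c − 1 ∈ S^{pᵐ}·ℤ[S]` whenever `pᵐ ∣ c` (no coprimality needed):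
`((1+S)^c − 1) b = S^{pᵐ}(V'(S) b)` for some polynomial `V'`. [cite: Washington1997, §13.2 (arithmetic in Λ/(p, T^n))] -/
theorem exists_unipotentPow_sub_self_eq_shiftEnd_pow (hM : ∀ x : M, p • x = 0) {m c : ℕ}
    (hc : p ^ m ∣ c) (b : Fin J → M) :
    ∃ w : Fin J → M, unipotentPow M J c b - b = (shiftEnd M J ^ (p ^ m)) w := by
  obtain ⟨u', rfl⟩ := hc
  obtain ⟨V', -, hV'⟩ := exists_poly_unipotentPow_sub_one_eq (J := J) hM m u'
  refine ⟨aeval (shiftEnd M J) V' b, ?_⟩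
  rw [← Module.End.mul_apply, ← hV', LinearMap.sub_apply, Module.End.one_apply]

/-- **Coboundary correction.**  If `x − S^{a₀} v = (1+S)^c b − b` on `Fin J → M` with `pᵐ ∣ c` and
`J ≤ 2pᵐ`, then `S^{pᵐ}·V(S)·x = V(S)·S^{pᵐ+a₀}·v` for every polynomial `V`: the coboundary term is
`S^{pᵐ}·(…)` and dies under the extra `S^{pᵐ}` (`S^{2pᵐ} = 0`).  In the application `x = φ₁(τ) mod T^J`,
`v = Φ(τ)`, `[φ₁ mod T^J] = [S^{a₀} ∘ Φ]`, `τ` of depth `m`. [cite: Washington1997, §13.2 (arithmetic in Λ/(p, T^n))] -/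
theorem shiftEnd_pow_aeval_apply_eq_of_sub_eq (hM : ∀ x : M, p • x = 0) {m c : ℕ} (hc : p ^ m ∣ c)
    (hJ : J ≤ 2 * p ^ m) (V : ℤ[X]) (x v b : Fin J → M) (a₀ : ℕ)
    (hcob : x - (shiftEnd M J ^ a₀) v = unipotentPow M J c b - b) :
    (shiftEnd M J ^ (p ^ m)) (aeval (shiftEnd M J) V x) =
      aeval (shiftEnd M J) V ((shiftEnd M J ^ (p ^ m + a₀)) v) := by
  obtain ⟨w, hw⟩ := exists_unipotentPow_sub_self_eq_shiftEnd_pow hM hc b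
  have hx : x = (shiftEnd M J ^ a₀) v + (shiftEnd M J ^ (p ^ m)) w := by
    rw [← hw, ← hcob, add_sub_cancel]
  have hcomm : shiftEnd M J ^ (p ^ m) * aeval (shiftEnd M J) V =
      aeval (shiftEnd M J) V * shiftEnd M J ^ (p ^ m) :=
    ((commute_aeval_self (shiftEnd M J) V).pow_left (p ^ m)).eq
  have h1 : (shiftEnd M J ^ (p ^ m)) (aeval (shiftEnd M J) V ((shiftEnd M J ^ a₀) v)) =
      aeval (shiftEnd M J) V ((shiftEnd M J ^ (p ^ m + a₀)) v) := by
    rw [← Module.End.mul_apply, hcomm, Module.End.mul_apply, ← Module.End.mul_apply (shiftEnd M J ^ (p ^ m)),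
      ← pow_add]
  have h2 : (shiftEnd M J ^ (p ^ m)) (aeval (shiftEnd M J) V ((shiftEnd M J ^ (p ^ m)) w)) = 0 := by
    rw [← Module.End.mul_apply, hcomm, Module.End.mul_apply, ← Module.End.mul_apply (shiftEnd M J ^ (p ^ m)),
      ← pow_add, shiftEnd_pow_eq_zero (by omega : J ≤ p ^ m + p ^ m), LinearMap.zero_apply, map_zero]
  rw [hx, map_add, map_add, h1, h2, add_zero]

end Coboundary

/-! ### §4 NET, pure algebra: `−(a' mod T^J) = U(S)·S^{pᵐ+a₀}·v`, `p ∤ U(0)` -/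

section Net

variable {M : Type*} [AddCommGroup M] {p : ℕ} [Fact p.Prime]

/-- **The value of the Kolyvagin cocycle, assembled (pure algebra).**  From the key relation
`φ̃ a' − a' = −P̄(φ̃) t` at level `L` (`φ̃ = (1+S)^{pᵐu}`, `p ∤ u`, `P̄ ≡ (1 − X)²`) and the coboundary
relation `(t mod T^J) − S^{a₀} v = (1+S)^c b − b` at level `J` (`pᵐ ∣ c`), for `J + pᵐ ≤ L` and
`J ≤ 2pᵐ`: `∃ U ∈ ℤ[X]` with `p ∤ U(0)` and `−(a' mod T^J) = U(S)·S^{pᵐ+a₀}·v` — the right-hand side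
of `stub_stepsTwoFourOdd` (`pᵐ = e'+1`, `v = Φ(Fr)`). MU-TRANSFER-PROOF §3 Lemma 2:
"`κ_q(σ̄) = U·T^e·t_1 (mod T^{2e}𝒯)`". [cite: PerrinRiou1998AIF, Prop. 3.1.6] [cite: Rubin2000, Thm. 4.5.4] -/
theorem exists_poly_neg_castLE_eq (hM : ∀ x : M, p • x = 0) (m u : ℕ) (hu : ¬ p ∣ u)
    {L J : ℕ} (hJL : J + p ^ m ≤ L) (hJ : J ≤ 2 * p ^ m) {Pz : ℤ[X]}
    (hPz : Pz.map (Int.castRingHom (ZMod p)) = ((1 - X) ^ 2 : ℤ[X]).map (Int.castRingHom (ZMod p)))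
    (a' t : Fin L → M)
    (hkey : unipotentPow M L (p ^ m * u) a' - a' = -(aeval (unipotentPow M L (p ^ m * u)) Pz t))
    {c : ℕ} (hc : p ^ m ∣ c) (v b : Fin J → M) (a₀ : ℕ)
    (hcob : (fun i : Fin J => t (Fin.castLE (by omega) i)) - (shiftEnd M J ^ a₀) v =
      unipotentPow M J c b - b) :
    ∃ U : ℤ[X], ¬ ((p : ℤ) ∣ U.coeff 0) ∧
      (fun i : Fin J => -a' (Fin.castLE (by omega) i)) =
        aeval (shiftEnd M J) U ((shiftEnd M J ^ (p ^ m + a₀)) v) := by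
  obtain ⟨V, hV0, hV⟩ := exists_poly_neg_castLE_eq_of_keyRelation hM m u hu hJL hPz a' t hkey
  refine ⟨V, ?_, ?_⟩
  · rw [hV0, Int.natCast_dvd_natCast]
    exact hu
  · rw [hV]
    exact shiftEnd_pow_aeval_apply_eq_of_sub_eq hM hc hJ V _ v b a₀ hcob

end Net

/-! ### §5 Galois currency: `𝒯_J = κ.twistModP ρ hM J`, an `E`-split `τ` of depth `m` -/

section Galois

universe u

variable {K : Type u} [Field K] {p : ℕ} [Fact p.Prime] (κ : ZpExtension K p)
  {M : Type u} [AddCommGroup M] [TopologicalSpace M] [DiscreteTopology M]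
  (ρ : DiscreteGaloisModule K M) (hM : ∀ x : M, p • x = 0)

omit [TopologicalSpace M] [DiscreteTopology M] in
include hM in
/-- **koly's exponent is the twist exponent.**  If `a ≡ κ̄_{n'}(τ) (mod p^{n'})` (the hypothesis
`(a : ZMod (p ^ n')) = κ.layerIndex n' τ` of `TameClass.exists_tameClass_of_isEulerSystemClass`) and
`n' ≤ L ≤ p^{n'}`, then `(1+S)^a = (1+S)^{twistExponent L τ}` on `Fin L → M` (both exponents agree
modulo `p^{n'}`, `natCast_twistExponent`; `(1+S)^{p^{n'}} = 1`, `unipotentPow_mod`).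
[cite: Washington1997, §13.1–§13.2] -/
theorem unipotentPow_eq_unipotentPow_twistExponent {L n' a : ℕ} (hn'L : n' ≤ L) (hLp : L ≤ p ^ n')
    {τ : absoluteGaloisGroup K} (ha : (a : ZMod (p ^ n')) = κ.layerIndex n' τ) :
    unipotentPow M L a = unipotentPow M L (κ.twistExponent L τ) := by
  have h : a % p ^ n' = κ.twistExponent L τ % p ^ n' := by
    rw [← ZMod.natCast_eq_natCast_iff', ha, κ.natCast_twistExponent n' L hn'L τ]
  rw [← unipotentPow_mod hM hLp a, h, unipotentPow_mod hM hLp]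

/-- An `E`-split element acts on `𝒯_J` through the twist character alone:
`𝒯_J(τ) x = (1+S)^{twistExponent J τ} x` when `ρ τ = 1`. [cite: Washington1997, §13.1–§13.2] -/
theorem twistModP_apply_of_apply_eq_one (J : ℕ) {τ : absoluteGaloisGroup K} (hρ : ρ τ = 1)
    (x : Fin J → M) :
    κ.twistModP ρ hM J τ x = unipotentPow M J (κ.twistExponent J τ) x := by
  rw [twistModP_apply]
  congr 1
  funext i
  rw [hρ]
  rfl

/-- For `τ ∈ Γ_m` and an `E`-split `τ` (`ρ τ = 1`): `𝒯_J(τ) b − b = (1+S)^c b − b` with `pᵐ ∣ c`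
(`c = twistExponent J τ` if `m ≤ J`; for `J < m` the element acts trivially and `c = 0`).
[cite: Washington1997, §13.1–§13.2] -/
theorem exists_dvd_twistModP_apply_sub_eq (J : ℕ) {m : ℕ} {τ : absoluteGaloisGroup K} (hρ : ρ τ = 1)
    (hτ : τ ∈ κ.layerSubgroup m) (b : Fin J → M) :
    ∃ c : ℕ, p ^ m ∣ c ∧ κ.twistModP ρ hM J τ b - b = unipotentPow M J c b - b := by
  by_cases hmJ : m ≤ J
  · exact ⟨κ.twistExponent J τ, κ.prime_pow_dvd_twistExponent hmJ hτ,
      by rw [twistModP_apply_of_apply_eq_one κ ρ hM J hρ]⟩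
  · refine ⟨0, dvd_zero _, ?_⟩
    have hJm : J ≤ m := by omega
    have hτJ : τ ∈ κ.layerSubgroup J := κ.layerSubgroup_antitone hJm hτ
    rw [twistModP_apply_of_mem_layerSubgroup κ ρ hM J le_rfl
      (Nat.lt_pow_self (Fact.out : p.Prime).one_lt).le hτJ, unipotentPow_zero, Module.End.one_apply]
    congr 1
    funext i
    rw [hρ]
    rfl

/-- **The value assembled, `twistModP` currency.**  Let `τ` be `E`-split of depth `m` (`ρ τ = 1`,
`τ ∈ Γ_m ∖ Γ_{m+1}`), `L` a level with `n' ≤ L ≤ p^{n'}` and `J + pᵐ ≤ L`, `J ≤ 2pᵐ`; let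
`a ≡ κ̄_{n'}(τ)` and `P̄ ≡ (1 − X)² (mod p)`.  If `a', t ∈ 𝒯_L` satisfy the KEY RELATION
`𝒯_L(τ) a' − a' = −P̄((1+S)^a) t` (x10's `exists_kolyvaginCocycle_value`, last clause, with koly's
`ψ'(g) = P̄((1+S)^a)(φ₁ g)` at `g = τ`, `t = φ₁ τ`) and `v, b ∈ 𝒯_J` satisfy the coboundary relation
`(t mod T^J) − S^{a₀} v = 𝒯_J(τ) b − b` (`exists_coboundary_apply_of_towerShift_iterate_eq` at `τ`),
then `−(a' mod T^J) = U(S)·S^{pᵐ+a₀}·v` for some `U ∈ ℤ[X]` with `p ∤ U(0)`.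
[cite: PerrinRiou1998AIF, Prop. 3.1.6] [cite: Rubin2000, Lemma 4.4.2 and Thm. 4.5.4] -/
theorem exists_poly_neg_castLE_eq_of_twistModP_keyRelation {m : ℕ} {τ : absoluteGaloisGroup K}
    (hρ : ρ τ = 1) (hτ : τ ∈ κ.layerSubgroup m) (hτ' : τ ∉ κ.layerSubgroup (m + 1))
    {L J n' : ℕ} (hn'L : n' ≤ L) (hLp : L ≤ p ^ n') (hJL : J + p ^ m ≤ L) (hJ : J ≤ 2 * p ^ m)
    {a : ℕ} (ha : (a : ZMod (p ^ n')) = κ.layerIndex n' τ) {Pz : ℤ[X]}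
    (hPz : Pz.map (Int.castRingHom (ZMod p)) = ((1 - X) ^ 2 : ℤ[X]).map (Int.castRingHom (ZMod p)))
    (a' t : Fin L → M)
    (hkey : κ.twistModP ρ hM L τ a' - a' = -(aeval (unipotentPow M L a) Pz t))
    (v b : Fin J → M) (a₀ : ℕ)
    (hcob : (fun i : Fin J => t (Fin.castLE (by omega) i)) - (shiftEnd M J ^ a₀) v =
      κ.twistModP ρ hM J τ b - b) :
    ∃ U : ℤ[X], ¬ ((p : ℤ) ∣ U.coeff 0) ∧
      (fun i : Fin J => -a' (Fin.castLE (by omega) i)) =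
        aeval (shiftEnd M J) U ((shiftEnd M J ^ (p ^ m + a₀)) v) := by
  -- depth: `twistExponent L τ = p^m · u`, `p ∤ u`
  have hmL : m + 1 ≤ L :=
    le_trans (Nat.lt_pow_self (Fact.out : p.Prime).one_lt) (le_trans (Nat.le_add_left _ _) hJL)
  obtain ⟨u, hu, hexp⟩ := twistExponent_eq_prime_pow_mul_of_depth κ hmL hτ hτ'
  -- koly's exponent `a` acts as `φ̃ = (1+S)^{p^m u}`
  have hφ : unipotentPow M L a = unipotentPow M L (p ^ m * u) := by
    rw [unipotentPow_eq_unipotentPow_twistExponent κ hM hn'L hLp ha, hexp]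
  have hkey' : unipotentPow M L (p ^ m * u) a' - a' =
      -(aeval (unipotentPow M L (p ^ m * u)) Pz t) := by
    rw [← hφ, ← hkey, twistModP_apply_of_apply_eq_one κ ρ hM L hρ, hexp, hφ]
  -- the coboundary relation at level `J`
  obtain ⟨c, hc, hcb⟩ := exists_dvd_twistModP_apply_sub_eq κ ρ hM J hρ hτ b
  rw [hcb] at hcob
  exact exists_poly_neg_castLE_eq hM m u hu hJL hJ hPz a' t hkey' hc v b a₀ hcob

/-- **From `towerShift^[a₀] κ' = 𝐳̄`, `[Φ] = κ'_J`, `[φ₁] = 𝐳̄_L` to a pointwise coboundary.**  For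
compatible families `κ', 𝐳̄ ∈ lim←_J H¹(K, 𝒯_J)` with `T^{a₀}κ' = 𝐳̄` (the stub's
`(κ.towerShift ρ hM)^[a] κ' = I.redTower s`), a cocycle `Φ` of `κ'_J` and a cocycle `φ₁` of `𝐳̄_L`
(`J ≤ L`): `[φ₁ mod T^J] = 𝐳̄_J = T^{a₀}[Φ] = [S^{a₀} ∘ Φ]`, so there is `b ∈ 𝒯_J` with
`(φ₁(g) mod T^J) − S^{a₀}Φ(g) = g·b − b` for all `g`. [cite: SerreGaloisCohomology1997, I §2.2]
[cite: MazurRubin2004, §5.3] -/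
theorem exists_coboundary_apply_of_towerShift_iterate_eq {a₀ : ℕ} (κ' z : κ.twistTower ρ hM)
    (hκ' : (κ.towerShift ρ hM)^[a₀] κ' = z) {J L : ℕ} (hJL : J ≤ L)
    (Φ : contOneCocycles (κ.twistModP ρ hM J).toTopRep)
    (hΦ : oneCocycleClass (κ.twistModP ρ hM J).toTopRep Φ = κ'.1 J)
    (φ₁ : contOneCocycles (κ.twistModP ρ hM L).toTopRep)
    (hφ₁ : oneCocycleClass (κ.twistModP ρ hM L).toTopRep φ₁ = z.1 L) :
    ∃ b : Fin J → M, ∀ g : absoluteGaloisGroup K,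
      (fun i : Fin J => φ₁.1 g (Fin.castLE hJL i)) - (shiftEnd M J ^ a₀) (Φ.1 g) =
        κ.twistModP ρ hM J g b - b := by
  -- `𝐳̄_J = [φ₁ mod T^J]`
  have h1 : z.1 J = oneCocycleClass (κ.twistModP ρ hM J).toTopRep
      (κ.pushCocycle ρ hM L (κ.twistModPTruncate ρ hM L hJL) φ₁) := by
    rw [← z.2 L J hJL, ← hφ₁]
    exact map_oneCocycleClass_twist κ ρ hM L _ φ₁
  -- `𝐳̄_J = T^{a₀}[Φ] = [S^{a₀} ∘ Φ]`
  have h2 : z.1 J = oneCocycleClass (κ.twistModP ρ hM J).toTopRep (κ.shiftPowCocycle ρ hM J a₀ Φ) := by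
    rw [← hκ', towerShift_iterate_apply_coe, ← hΦ, shiftH1_iterate_oneCocycleClass]
  have h12 : oneCocycleClass (κ.twistModP ρ hM J).toTopRep
      (κ.pushCocycle ρ hM L (κ.twistModPTruncate ρ hM L hJL) φ₁) =
      oneCocycleClass (κ.twistModP ρ hM J).toTopRep (κ.shiftPowCocycle ρ hM J a₀ Φ) :=
    h1.symm.trans h2
  rw [← sub_eq_zero, ← oneCocycleClass_sub, oneCocycleClass_eq_zero_iff] at h12
  obtain ⟨b, hb⟩ := h12
  refine ⟨b, fun g => ?_⟩
  have hg := hb g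
  rw [Submodule.coe_sub, ContinuousMap.sub_apply, pushCocycle_apply, shiftPowCocycle_apply] at hg
  have htr : (κ.twistModPTruncate ρ hM L hJL) (φ₁.1 g) = fun i : Fin J => φ₁.1 g (Fin.castLE hJL i) :=
    funext fun i => twistModPTruncate_apply κ ρ hM L hJL (φ₁.1 g) i
  rw [htr] at hg
  exact hg

/-- **The value assembled, tower currency (lur-b's `hTame` clause (V) / the stub's right-hand
side).**  Data: the stub's `a₀`, `κ'`, `(κ.towerShift ρ hM)^[a₀] κ' = 𝐳̄` (`= I.redTower s`), `Φ` a
cocycle of `κ'_J`, `φ₁` a cocycle of `𝐳̄_L` (koly's `φ`), `e' + 1 = pᵐ`, `J ≤ 2pᵐ`, `J + pᵐ ≤ L`,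
`n' ≤ L ≤ p^{n'}`; an `E`-split `τ` of depth `m`; koly's operator data `a ≡ κ̄_{n'}(τ)`,
`P̄ ≡ (1 − X)²`; and `a' ∈ 𝒯_L` with the key relation `𝒯_L(τ) a' − a' = −P̄((1+S)^a)(φ₁ τ)` (x10's
`exists_kolyvaginCocycle_value` fed with koly's `ψ'`).  THEN
`∃ U ∈ ℤ[X]`, `p ∤ U(0)`, `−(a' mod T^J) = U(S)·S^{e'+1+a₀}·Φ(τ)`.  With x10's
`Φ_q(res τ_q) = −(a' mod T^J)` this is the VALUE `c(res τ_q) = U(S)·S^{e'+1+a}·Φ(Fr)` of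
MU-TRANSFER-PROOF Lemma 2 in the stub's currency. [cite: PerrinRiou1998AIF, Prop. 3.1.6]
[cite: Rubin2000, Lemma 4.4.2 and Thm. 4.5.4] [cite: MazurRubin2004, §5.3] -/
theorem exists_poly_neg_castLE_eq_of_towerShift_iterate_eq {a₀ : ℕ} (κ' z : κ.twistTower ρ hM)
    (hκ' : (κ.towerShift ρ hM)^[a₀] κ' = z) {m e' J L n' : ℕ} (he : e' + 1 = p ^ m)
    (hJ : J ≤ 2 * p ^ m) (hJL : J + p ^ m ≤ L) (hn'L : n' ≤ L) (hLp : L ≤ p ^ n')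
    (Φ : contOneCocycles (κ.twistModP ρ hM J).toTopRep)
    (hΦ : oneCocycleClass (κ.twistModP ρ hM J).toTopRep Φ = κ'.1 J)
    (φ₁ : contOneCocycles (κ.twistModP ρ hM L).toTopRep)
    (hφ₁ : oneCocycleClass (κ.twistModP ρ hM L).toTopRep φ₁ = z.1 L)
    {τ : absoluteGaloisGroup K} (hρ : ρ τ = 1) (hτ : τ ∈ κ.layerSubgroup m)
    (hτ' : τ ∉ κ.layerSubgroup (m + 1))
    {a : ℕ} (ha : (a : ZMod (p ^ n')) = κ.layerIndex n' τ) {Pz : ℤ[X]}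
    (hPz : Pz.map (Int.castRingHom (ZMod p)) = ((1 - X) ^ 2 : ℤ[X]).map (Int.castRingHom (ZMod p)))
    (a' : Fin L → M)
    (hkey : κ.twistModP ρ hM L τ a' - a' = -(aeval (unipotentPow M L a) Pz (φ₁.1 τ))) :
    ∃ U : ℤ[X], ¬ ((p : ℤ) ∣ U.coeff 0) ∧
      (fun i : Fin J => -a' (Fin.castLE (by omega) i)) =
        aeval (shiftEnd M J) U ((shiftEnd M J ^ (e' + 1 + a₀)) (Φ.1 τ)) := by
  obtain ⟨b, hb⟩ := exists_coboundary_apply_of_towerShift_iterate_eq κ ρ hM κ' z hκ'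
    (by omega : J ≤ L) Φ hΦ φ₁ hφ₁
  rw [he]
  exact exists_poly_neg_castLE_eq_of_twistModP_keyRelation κ ρ hM hρ hτ hτ' hn'L hLp hJL hJ ha hPz
    a' (φ₁.1 τ) hkey (Φ.1 τ) b a₀ (hb τ)

/-- **The value assembled, in the literal exponents of `stub_stepsTwoFourOdd`.**  The previous
theorem with the stub's bookkeeping: `p` odd, `e' + 1 = pⁿ`, `J = 2e'+1+1`, `L = p^{n+1}` (koly's
layer `n+1`, so `J + pⁿ = 3pⁿ ≤ L`), the `E`-split `τ` of depth `n`, koly's exponent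
`a ≡ κ̄_{n+1}(τ) (mod p^{n+1})`; `hJL` is the consumer's own proof of `J ≤ L` (any proof — the
truncation `Fin.castLE hJL` of x10's `Φ_q(res τ_q) = fun i ↦ −a' (Fin.castLE hJL i)`).  Conclusion:
`∃ U ∈ ℤ[X]`, `¬ (p:ℤ) ∣ U.coeff 0`, `(fun i ↦ −a' (Fin.castLE hJL i)) = U(S)·(S^{e'+1+a₀} (Φ τ))` —
the right-hand side of the stub VERBATIM up to the names `U`, `a₀ ↦ a`, `τ ↦ Fr`.
[cite: PerrinRiou1998AIF, Prop. 3.1.6] [cite: Rubin2000, Lemma 4.4.2 and Thm. 4.5.4]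
[cite: MazurRubin2004, §5.3] -/
theorem exists_poly_neg_castLE_eq_stubLevels (hp2 : p ≠ 2) {a₀ : ℕ} (κ' z : κ.twistTower ρ hM)
    (hκ' : (κ.towerShift ρ hM)^[a₀] κ' = z) {n e' : ℕ} (he : e' + 1 = p ^ n)
    (hJL : 2 * e' + 1 + 1 ≤ p ^ (n + 1))
    (Φ : contOneCocycles (κ.twistModP ρ hM (2 * e' + 1 + 1)).toTopRep)
    (hΦ : oneCocycleClass (κ.twistModP ρ hM (2 * e' + 1 + 1)).toTopRep Φ = κ'.1 (2 * e' + 1 + 1))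
    (φ₁ : contOneCocycles (κ.twistModP ρ hM (p ^ (n + 1))).toTopRep)
    (hφ₁ : oneCocycleClass (κ.twistModP ρ hM (p ^ (n + 1))).toTopRep φ₁ = z.1 (p ^ (n + 1)))
    {τ : absoluteGaloisGroup K} (hρ : ρ τ = 1) (hτ : τ ∈ κ.layerSubgroup n)
    (hτ' : τ ∉ κ.layerSubgroup (n + 1))
    {a : ℕ} (ha : (a : ZMod (p ^ (n + 1))) = κ.layerIndex (n + 1) τ) {Pz : ℤ[X]}
    (hPz : Pz.map (Int.castRingHom (ZMod p)) = ((1 - X) ^ 2 : ℤ[X]).map (Int.castRingHom (ZMod p)))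
    (a' : Fin (p ^ (n + 1)) → M)
    (hkey : κ.twistModP ρ hM (p ^ (n + 1)) τ a' - a' =
      -(aeval (unipotentPow M (p ^ (n + 1)) a) Pz (φ₁.1 τ))) :
    ∃ U : ℤ[X], ¬ ((p : ℤ) ∣ U.coeff 0) ∧
      (fun i : Fin (2 * e' + 1 + 1) => -a' (Fin.castLE hJL i)) =
        aeval (shiftEnd M (2 * e' + 1 + 1)) U
          ((shiftEnd M (2 * e' + 1 + 1) ^ (e' + 1 + a₀)) (Φ.1 τ)) := by
  have hp : p.Prime := Fact.out
  have h3 : 3 ≤ p := Nat.succ_le_of_lt (lt_of_le_of_ne hp.two_le (Ne.symm hp2))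
  have hJ : 2 * e' + 1 + 1 ≤ 2 * p ^ n := by rw [← he]; omega
  have hJL' : 2 * e' + 1 + 1 + p ^ n ≤ p ^ (n + 1) :=
    calc 2 * e' + 1 + 1 + p ^ n = 3 * p ^ n := by rw [← he]; ring
      _ ≤ p * p ^ n := Nat.mul_le_mul_right _ h3
      _ = p ^ (n + 1) := by rw [pow_succ']
  have hn'L : n + 1 ≤ p ^ (n + 1) := (Nat.lt_pow_self hp.one_lt).le
  exact exists_poly_neg_castLE_eq_of_towerShift_iterate_eq κ ρ hM κ' z hκ' he hJ hJL' hn'L le_rfl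
    Φ hΦ φ₁ hφ₁ hρ hτ hτ' ha hPz a' hkey

end Galois

end Summit.BirchSwinnertonDyer.BirchSwinnertonDyer.Rank1Residual.KolyvaginTwist

end
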